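import Summits.ABC.StewartYu.PadicG3TwoSlabKStep
import HarnessLib

/-!
# Cell abc-stewartyu, Gen-3 frame at `p = 2` (crux `Y07Two`, stmt-ABC-19659), layer F4b/F4c-SLAB, POINTWISE `M₀`:
# the slab k-step and inner chain with pointwise `Y₀`-weight sizes (repair of defect D1)

`Summits/ABC/StewartYu/PadicG3TwoSlabKStepPt.lean` — cell `abc-stewartyu` (HOME `run/shared/lean/pub/abc-stewartyu/`),
route `PadicPrimesKummerThird`, seat p3 (g5), F-two LEAD.  Theorems on `TwoSetup`; sequel to
`PadicG3TwoSlabKStep.lean`.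

DEFECT D1 (p5-g3, 2026-08-27): `g3_slab_kstep` / `g3_slab_kchain` (and the slab-less `g3_kstep` / `g3_kchain`)
take ONE integer `M₀` with `|den₀·(Hasse_{t} Rᵢ)(x)| ≤ M₀` for ALL integers `x` — only constant `Rᵢ` qualify, so
those theorems, while true, are vacuous for the frame's `Rᵢ = Δ(Y₀; ℓ₀, H)`.  Here `M₀ : ℤ → Tau → ℤ` is POINTWISE
(as `PadicG3TwoFeldmanBasis.exists_int_lcm_pow_mul_hasse_feldR` supplies it, and as p5-g3's `G3Adm.hasse`
records it); the proofs are those of the originals verbatim, since Liouville (`g3φ_eq_zero_of_norm_lt`) is applied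
at one point `(x₁, τ)`.  p5-g3's `PadicG3TwoSlabKStepOn` generalises further to node SUBSETS (first step after a
third step: nodes coprime to `3`); these full-range versions serve the steps `k ≥ 1`.

WHAT THIS IS NOT: no parameter choice; no crux moves.

References: K. Yu, Acta Math. 211 (2013), Lemma 5.2; K. Yu, Acta Arith. 89 (1999), §2.
-/

noncomputable section

open NormedSpace Finset IsUltrametricDist Polynomial Metric Filter
open Literature.NumberTheory.Transcendental
open Literature.NumberTheory.Transcendental.PadicCW77 (condExp)
open scoped Nat Topology

namespace Summit.ABC.StewartYu

open Literature.NumberTheory.Transcendental.CW77.Setup (Tau tauNorm)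

namespace TwoSetup

variable (S : TwoSetup) {ι : Type*} (R : ι → ℚ[X]) (u : ι → Fin S.d → ℤ) (uθ : ι → ℤ)

/-! ### Pointwise `Y₀`-weight sizes

`PadicG3TwoSlabKStep.g3_slab_kstep` / `g3_slab_kchain` take ONE integer `M₀` bounding `den₀·(Hasse Rᵢ)(x)` at ALL integers
`x`, which only constant `Rᵢ` satisfy (true but vacuous for the frame's `Rᵢ = Δ(Y₀; ℓ₀, H)`).  The variants below
take `M₀ : ℤ → Tau → ℤ` POINTWISE (as `PadicG3TwoFeldmanBasis.exists_int_lcm_pow_mul_hasse_feldR` supplies it);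
the proofs are unchanged because Liouville (`g3φ_eq_zero_of_norm_lt`) is applied at one point. -/

/-- **The `2`-adic k-step ON THE SLAB, pointwise `M₀`** (use this one). [cite: Yu2013, Lemma 5.2] [cite: Yu1999, §2] -/
theorem g3_slab_kstep_pt (B : Finset ι) (p : ι → ℤ) (i₀ : ι) {m : ℕ}
    (hslab : ∀ i ∈ B, ‖S.δexpo u uθ i₀ i‖ ≤ ((2 : ℝ) ^ (m + 3))⁻¹) {N N' Tlo t : ℕ} (ht : 1 ≤ t)
    {Bw : ℝ} (hBw0 : 0 ≤ Bw) (hBw : ∀ i ∈ B, ∀ t₀ k, ‖(hw R i t₀).coeff k‖ * (4 * (2 : ℝ) ^ m) ^ k ≤ Bw)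
    (hzero : ∀ x : ℤ, |x| ≤ (N : ℤ) → ∀ τ'' : Tau S.d, tauNorm τ'' < Tlo →
      S.g3φ R u uθ B p τ'' x = 0)
    {Dbox : Fin S.d → ℕ} {Dθ : ℕ} (hu : ∀ i ∈ B, ∀ j, |u i j| ≤ (Dbox j : ℤ))
    (huθ : ∀ i ∈ B, |uθ i| ≤ (Dθ : ℤ))
    (den₀ : ℤ → Tau S.d → ℕ) (hden₀ : ∀ x τ, 1 ≤ den₀ x τ) (M₀ : ℤ → Tau S.d → ℤ)
    (hR : ∀ (x : ℤ) (τ : Tau S.d), ∀ i ∈ B,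
      ∃ z₀ : ℤ, (den₀ x τ : ℚ) * (hasseDeriv τ.1 (R i)).eval (x : ℚ) = z₀ ∧ |z₀| ≤ M₀ x τ)
    {Xb : ℤ} (hX : ∀ i ∈ B, ∀ j, |S.dirScalar (u i) (uθ i) j| ≤ Xb) {P : ℤ} (hP : ∀ i ∈ B, |p i| ≤ P)
    (K : ℤ → Tau S.d → ℝ) (hK0 : ∀ x τ, 0 < K x τ)
    (hK : ∀ (x : ℤ) (τ : Tau S.d), (B.card : ℝ) * P * ((M₀ x τ : ℝ) * (Xb : ℝ) ^ (∑ j, τ.2 j) *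
      ((MonomialDen.monDen S.toQ.all (S.boxExp Dbox Dθ x) : ℝ)) ^ 2) ≤ K x τ)
    (hfinal : ∀ x₁ : ℤ, |x₁| ≤ (N' : ℤ) → ∀ τ : Tau S.d, tauNorm τ + t ≤ Tlo →
      max (Bw * ‖S.Λ₀‖ * (2 : ℝ) ^ t * (2 : ℝ) ^ condExp 2 (2 * N + 1) t)
        (Bw / (4 * (2 : ℝ) ^ m) ^ ((2 * N + 1) * t)) < 1 / K x₁ τ) :
    ∀ x₁ : ℤ, |x₁| ≤ (N' : ℤ) → ∀ τ : Tau S.d, tauNorm τ + t ≤ Tlo →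
      S.g3φ R u uθ B p τ x₁ = 0 := by
  intro x₁ hx₁ τ hτ
  have hz : ‖((x₁ : ℤ) : ℚ_[2])‖ ≤ 1 := Padic.norm_int_le_one (p := 2) x₁
  have hcore := (S.norm_g3G_le_of_zeros R u uθ B p i₀ hslab ht hBw0 hBw hzero hz τ hτ).2
  rw [S.g3Φ_intCast] at hcore
  exact S.g3φ_eq_zero_of_norm_lt R u uθ B p hu huθ τ x₁ (hden₀ x₁ τ) (hR x₁ τ) hX hP (hK x₁ τ)
    (hK0 x₁ τ) (lt_of_le_of_lt hcore (hfinal x₁ hx₁ τ hτ))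

/-- **The inner chain ON THE SLAB, pointwise `M₀`** (use this one). [cite: Yu2013, Lemma 5.2] -/
theorem g3_slab_kchain_pt (B : Finset ι) (p : ι → ℤ) (i₀ : ι) {m : ℕ}
    (hslab : ∀ i ∈ B, ‖S.δexpo u uθ i₀ i‖ ≤ ((2 : ℝ) ^ (m + 3))⁻¹) {T t : ℕ} (ht : 1 ≤ t)
    (Nsched : ℕ → ℕ)
    {Bw : ℝ} (hBw0 : 0 ≤ Bw) (hBw : ∀ i ∈ B, ∀ t₀ k, ‖(hw R i t₀).coeff k‖ * (4 * (2 : ℝ) ^ m) ^ k ≤ Bw)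
    (hzero0 : ∀ x : ℤ, |x| ≤ (Nsched 0 : ℤ) → ∀ τ : Tau S.d, tauNorm τ < T →
      S.g3φ R u uθ B p τ x = 0)
    {Dbox : Fin S.d → ℕ} {Dθ : ℕ} (hu : ∀ i ∈ B, ∀ j, |u i j| ≤ (Dbox j : ℤ))
    (huθ : ∀ i ∈ B, |uθ i| ≤ (Dθ : ℤ))
    (den₀ : ℤ → Tau S.d → ℕ) (hden₀ : ∀ x τ, 1 ≤ den₀ x τ) (M₀ : ℤ → Tau S.d → ℤ)
    (hR : ∀ (x : ℤ) (τ : Tau S.d), ∀ i ∈ B,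
      ∃ z₀ : ℤ, (den₀ x τ : ℚ) * (hasseDeriv τ.1 (R i)).eval (x : ℚ) = z₀ ∧ |z₀| ≤ M₀ x τ)
    {Xb : ℤ} (hX : ∀ i ∈ B, ∀ j, |S.dirScalar (u i) (uθ i) j| ≤ Xb) {P : ℤ} (hP : ∀ i ∈ B, |p i| ≤ P)
    (K : ℤ → Tau S.d → ℝ) (hK0 : ∀ x τ, 0 < K x τ)
    (hK : ∀ (x : ℤ) (τ : Tau S.d), (B.card : ℝ) * P * ((M₀ x τ : ℝ) * (Xb : ℝ) ^ (∑ j, τ.2 j) *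
      ((MonomialDen.monDen S.toQ.all (S.boxExp Dbox Dθ x) : ℝ)) ^ 2) ≤ K x τ)
    (hfinal : ∀ k, ∀ x₁ : ℤ, |x₁| ≤ (Nsched (k + 1) : ℤ) → ∀ τ : Tau S.d, tauNorm τ + t ≤ T - k * t →
      max (Bw * ‖S.Λ₀‖ * (2 : ℝ) ^ t * (2 : ℝ) ^ condExp 2 (2 * Nsched k + 1) t)
        (Bw / (4 * (2 : ℝ) ^ m) ^ ((2 * Nsched k + 1) * t)) < 1 / K x₁ τ) :
    ∀ k, ∀ x : ℤ, |x| ≤ (Nsched k : ℤ) → ∀ τ : Tau S.d, tauNorm τ < T - k * t →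
      S.g3φ R u uθ B p τ x = 0 := by
  intro k
  induction k with
  | zero =>
    intro x hx τ hτ
    exact hzero0 x hx τ (by simpa using hτ)
  | succ k ih =>
    intro x hx τ hτ
    have key := S.g3_slab_kstep_pt R u uθ B p i₀ hslab (N := Nsched k) (N' := Nsched (k + 1))
      (Tlo := T - k * t) ht hBw0 hBw ih hu huθ den₀ hden₀ M₀ hR hX hP K hK0 hK (hfinal k)
    refine key x hx τ ?_
    rw [Nat.succ_mul] at hτ
    omega

end TwoSetup

end Summit.ABC.StewartYu

end
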